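import Summits.QuantumFields.YangMills.Theorems.UnitScaleTiltProp7FrameMassStep
import Summits.QuantumFields.YangMills.Theorems.UnitScaleTiltProp7R0OfFrameRowsT3
import HarnessLib

/-!
# `UnitScaleTiltProp7FrameRem2Step` — THE ONE-STEP ACCUMULATED-FRAME INEQUALITY AT SECOND ORDER, IN `ℓ¹` (generic level `k`, every input displayed; R0-RECURSION file F-α):
# **`Ψ_{k+1} ≤ (Lᵈ)⁻¹·Ψ_k + S_k + 19·C_R²·Σ_y B(y) + 91·Φ_k`** — the centre frame cancels EXACTLY (✓`Prop7AccumulatedFrameStep.mul_eml_sub_one_eq`), so the second-order remainders of the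
# accumulated frames are DAMPED by the block mean with NO variation term
(route `UnitScaleTilt`, crux K1 «MinimiserStabilityRegPr» stmt-QuantumFields-19200; ★★OWNER ym3-torus-plan g29 RULING №19 (3) «R0-RECURSION FILE := px13 g6»; LOCATE `LOCATE-R0-RECURSION-px13g6.md`
(19200 evidence #57) §1; twin AT SECOND ORDER of ✓px22 `Prop7FrameMassStep.frameMass_step_le` (F3″-B2c); def-free, count-neutral).
Cell `ym3-torus` (HUMAN RULING D-0037, YM ladder rung R3 — YM₃ on T³ is a rung, not d = 4, not infinite volume, not a mass gap, not Clay), width seat `ym3-torus-px13` (gen 6).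

THE PRINT.  [Balaban1985Averaging] (97) p. 32 `v_{k+1}(y) = v_k(y)·w_k(y)`, (82) p. 30 `w = exp(mean log)` of the stair transports, (26)–(27) p. 22 (log∕exp of near-unit products to second
order); [Balaban1987RG1] (0.3)–(0.4) pp. 252–253 (blocks, block means).  The accumulated frames enter the (β) row of the E2E through the second-order remainder of the frame RATIO (px16 g5
LOCATE R0, no print analogue); by ✓`Prop7R0OfFrameRows` that row is the sum of ONE-tower rows, and this file is the one-tower second-order step.

LETTERS (✓`Prop7AccumulatedFrameStep`∕✓`Prop7FrameMassStep`, level `k`, coarse site `y`, `c = emb y`, index family `i : Idx P`, block point `x_i = emb y + disp st_i = blockSite y i.1`):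
`v_k = frameAccU k U₀ W`, `ν_i = Ū₀⁽ᵏ⁾(st_i)` (BACKGROUND stair transport — it does not depend on the competitor, hence carries no linear part), `R_i = Ū⁽ᵏ⁾(st_i)·ν_i⁻¹` (single-bar stair ratio),
`a_i = ν_i·v_k(x_i)·ν_i⁻¹`, `v_{k+1}(y) = v_k(c)·eml_i(v_k(c)⁻¹·R_i·a_i)` (✓`frameAccU_succ`, ✓`coe_vframeCovU`, ✓`tstairU_eq_frame_inv_mul`).  «LINEAR PARTS» are ABSTRACT: `ℓ_k : Site P k → 𝔸`
for the frames, `ℓR : Site P (k+1) → Idx P → 𝔸` for the stair ratios; the new frame's is **`ℓ_{k+1}(y) := |Idx|⁻¹Σ_i (ℓR y i + ν_i·ℓ_k(x_i)·ν_i⁻¹)`** (the top identification with `fderiv` is ★routeR-w2 g9's R0-LIN).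

WHAT IS PROVED (sorry-free, no definition; `𝔸` any complete normed ℂ-algebra, `P` any `Params`):
* §1 [folklore] abstract: `norm_conj_sub_one_sub_le` (`‖νXν⁻¹ − 1 − νℓν⁻¹‖ ≤ ‖X − 1 − ℓ‖`, bi-contractive `ν`), ★★ `norm_mul_eml_sub_one_sub_mean_le` (`‖v·eml_i(v⁻¹b_i) − 1 − mean_i ℓ_i‖ ≤
  mean_i ‖b_i − 1 − ℓ_i‖ + 6t²`), ★★ `norm_mul_eml_sub_one_sub_mean_le_split` (with `b_i = R_ia_i`: `+ ‖R_i − 1‖·‖a_i − 1‖`, ✓`Prop7R0OfFrameRows.norm_mul_sub_one_sub_add_le`).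
* §2 ★★ `norm_frameAccU_succ_sub_one_sub_lin_le` — POINTWISE: `‖v_{k+1}(y) − 1 − ℓ_{k+1}(y)‖ ≤ |Idx|⁻¹Σ_i (‖R_i − 1 − ℓR y i‖ + ‖v_k(x_i) − 1 − ℓ_k(x_i)‖ + ‖R_i − 1‖·‖a_i − 1‖) + 6t²`.
* §3 ★★★ `frameRem2_step_le` — IN `ℓ¹` over the coarse sites, under ✓`frameMass_step_le`'s displayed rows VERBATIM (U1, sup `δ₂`, stair `C_R√B`, `t* = ρ + 3δ₂ ≤ ¼`) plus the abstract remainder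
  letters `hE : ‖v_k(x) − 1 − ℓ_k(x)‖ ≤ E x`, `hSR : ‖R_i(y) − 1 − ℓR y i‖ ≤ SR y i`:
  `Σ_y ‖v_{k+1}(y) − 1 − ℓ_{k+1}(y)‖ ≤ (Lᵈ)⁻¹·Σ_x E x + Σ_y |Idx|⁻¹Σ_i SR y i + 19·C_R²·Σ_y B y + 91·Σ_x ‖v_k(x) − 1‖²` (✓`idxMean_eq_blockMean` + block tiling; AM–GM; px22's local sup
  `6t_y² ≤ 18(C_R²B(y) + V(y) + 4‖v_k(c) − 1‖²)`).
HONEST FRAMING.  Algebra + bookkeeping over px22's letters; no smallness produced; the stair remainder row `SR` and the T³ currencies are F-β∕F-γ (LOCATE §2–§3); nothing of (β)∕hPA2∕hcoS∕E′∕EX∕the crux is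
proved; rung R3, not Clay; YM gap NOT proved.  `--supports stmt-QuantumFields-19200 --as helper`.
References: T. Bałaban, CMP 98 (1985) 17–51 [Balaban1985Averaging] ((26)–(27) p.22, (58) p.27, (82) p.30, (97) p.32, Prop. 3 (122)–(126) p.36); CMP 109 (1987) 249–301 [Balaban1987RG1] ((0.3)–(0.4) pp.252–253).
-/

set_option autoImplicit false

noncomputable section

open scoped BigOperators

namespace Summit.QuantumFields.YangMills.Theorems.Prop7FrameRem2Step

open Finset
open Literature.MathematicalPhysics.QuantumFieldTheory.Balaban1983to89
open T4Continuum T4ReflectionCone BlockAveraging AveragingRT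
open ExpMeanLog (eml)
open BlockAveragingEMLProp2 (norm_eml_sub_one_sub_mean_le)
open B10Eq27TorusAxialLog (holT transl)
open B7Prop1Explicit (disp)
open Summit.QuantumFields.YangMills.Theorems.Prop8Chart (emlIterU)
open Summit.QuantumFields.YangMills.Theorems.Prop7SymAvgTwSym (tstairU frameAccU frameAccU_succ coe_vframeCovU dbarCovIterU)
open Summit.QuantumFields.YangMills.Theorems.Prop7AccumulatedFrameStep (mul_eml_sub_one_eq norm_mean_le_mean tstairU_eq_frame_inv_mul norm_inv_mul_sub_one_le)
open Summit.QuantumFields.YangMills.Theorems.Prop7FrameMassStep (norm_conj_sub_one_le norm_conj_le_one sum_emb_le)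
open Summit.QuantumFields.YangMills.Theorems.Prop7BlockMeanContraction (transl_emb_disp_stairWord_eq_blockSite idxMean_eq_blockMean sum_sq_idxMean_le sum_sum_block_eq)
open Summit.QuantumFields.YangMills.Theorems.LinearLiftGauge (sum_blockSite_eq)
open Summit.QuantumFields.YangMills.Theorems.Prop7R0OfFrameRows (norm_mul_sub_one_sub_add_le)

/-! ## §1 Abstract: the centre frame cancels, second-order version -/

section Abstract

variable {𝔸 : Type*} [NormedRing 𝔸] [NormedAlgebra ℂ 𝔸] [CompleteSpace 𝔸] {ι : Type*} [Fintype ι] [Nonempty ι]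

omit [NormedAlgebra ℂ 𝔸] [CompleteSpace 𝔸] [Fintype ι] [Nonempty ι] in
/-- conjugation by a bi-contractive unit does not increase a second-order remainder: `‖νXν⁻¹ − 1 − νℓν⁻¹‖ ≤ ‖X − 1 − ℓ‖`. [folklore] -/
theorem norm_conj_sub_one_sub_le (ν : 𝔸ˣ) (X ℓ : 𝔸) (h1 : ‖(ν : 𝔸)‖ ≤ 1) (h2 : ‖((ν⁻¹ : 𝔸ˣ) : 𝔸)‖ ≤ 1) :
    ‖(ν : 𝔸) * X * ((ν⁻¹ : 𝔸ˣ) : 𝔸) - 1 - (ν : 𝔸) * ℓ * ((ν⁻¹ : 𝔸ˣ) : 𝔸)‖ ≤ ‖X - 1 - ℓ‖ := by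
  have e : (ν : 𝔸) * X * ((ν⁻¹ : 𝔸ˣ) : 𝔸) - 1 - (ν : 𝔸) * ℓ * ((ν⁻¹ : 𝔸ˣ) : 𝔸) = (ν : 𝔸) * (X - 1 - ℓ) * ((ν⁻¹ : 𝔸ˣ) : 𝔸) := by
    rw [mul_sub, mul_sub, sub_mul, sub_mul, mul_one, Units.mul_inv]
  rw [e]
  calc ‖(ν : 𝔸) * (X - 1 - ℓ) * ((ν⁻¹ : 𝔸ˣ) : 𝔸)‖ ≤ ‖(ν : 𝔸)‖ * ‖X - 1 - ℓ‖ * ‖((ν⁻¹ : 𝔸ˣ) : 𝔸)‖ :=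
        (norm_mul_le _ _).trans (mul_le_mul_of_nonneg_right (norm_mul_le _ _) (norm_nonneg _))
    _ ≤ 1 * ‖X - 1 - ℓ‖ * 1 := by gcongr
    _ = ‖X - 1 - ℓ‖ := by ring

omit [CompleteSpace 𝔸] [Nonempty ι] in
/-- the mean splits over a pointwise difference: `mean(b_i − 1) − mean ℓ_i = mean(b_i − 1 − ℓ_i)`. [folklore] -/
theorem mean_sub_mean (b ℓ : ι → 𝔸) :
    ((Fintype.card ι : ℂ))⁻¹ • ∑ i, (b i - 1) - ((Fintype.card ι : ℂ))⁻¹ • ∑ i, ℓ i = ((Fintype.card ι : ℂ))⁻¹ • ∑ i, (b i - 1 - ℓ i) := by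
  rw [← smul_sub, ← Finset.sum_sub_distrib]

/-- ★★ **THE CENTRE FRAME CANCELS — SECOND-ORDER VERSION**: `‖v‖ ≤ 1`, every `‖v⁻¹b_i − 1‖ ≤ t ≤ ¼`, arbitrary «linear parts» `ℓ_i` ⟹
`‖v·eml_i(v⁻¹b_i) − 1 − mean_i ℓ_i‖ ≤ mean_i ‖b_i − 1 − ℓ_i‖ + 6t²` (✓`mul_eml_sub_one_eq` + lit ✓`norm_eml_sub_one_sub_mean_le`). [cite: Balaban1985Averaging, (26)-(27) p.22, (97) p.32] -/
theorem norm_mul_eml_sub_one_sub_mean_le (v : 𝔸ˣ) (hv : ‖(v : 𝔸)‖ ≤ 1) (b ℓ : ι → 𝔸) {t : ℝ}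
    (ht : ∀ i, ‖((v⁻¹ : 𝔸ˣ) : 𝔸) * b i - 1‖ ≤ t) (ht4 : t ≤ 1 / 4) :
    ‖(v : 𝔸) * eml (fun i => ((v⁻¹ : 𝔸ˣ) : 𝔸) * b i) - 1 - ((Fintype.card ι : ℂ))⁻¹ • ∑ i, ℓ i‖
      ≤ (Fintype.card ι : ℝ)⁻¹ * ∑ i, ‖b i - 1 - ℓ i‖ + 6 * t ^ 2 := by
  rw [mul_eml_sub_one_eq, add_sub_right_comm, mean_sub_mean]
  refine (norm_add_le _ _).trans (add_le_add (norm_mean_le_mean fun i => le_rfl) ?_)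
  have hQ := norm_eml_sub_one_sub_mean_le (W := fun i => ((v⁻¹ : 𝔸ˣ) : 𝔸) * b i) ht ht4
  calc ‖(v : 𝔸) * (eml (fun i => ((v⁻¹ : 𝔸ˣ) : 𝔸) * b i) - 1 - ((Fintype.card ι : ℂ))⁻¹ • ∑ i, (((v⁻¹ : 𝔸ˣ) : 𝔸) * b i - 1))‖
      ≤ ‖(v : 𝔸)‖ * ‖eml (fun i => ((v⁻¹ : 𝔸ˣ) : 𝔸) * b i) - 1 - ((Fintype.card ι : ℂ))⁻¹ • ∑ i, (((v⁻¹ : 𝔸ˣ) : 𝔸) * b i - 1)‖ := norm_mul_le _ _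
    _ ≤ 1 * (6 * t ^ 2) := mul_le_mul hv hQ (norm_nonneg _) zero_le_one
    _ = 6 * t ^ 2 := one_mul _

/-- ★★ **WITH THE STAIR SPLIT `b_i = R_i·a_i` AND LINEAR PARTS `ℓR_i + ℓa_i`**: `‖v·eml_i(v⁻¹R_ia_i) − 1 − mean_i(ℓR_i + ℓa_i)‖ ≤ mean_i(‖R_i − 1 − ℓR_i‖ + ‖a_i − 1 − ℓa_i‖ + ‖R_i − 1‖·‖a_i − 1‖) + 6t²`
(product rule ✓`Prop7R0OfFrameRows.norm_mul_sub_one_sub_add_le`). [cite: Balaban1985Averaging, (58) p.27, (82) p.30, (97) p.32] -/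
theorem norm_mul_eml_sub_one_sub_mean_le_split (v : 𝔸ˣ) (hv : ‖(v : 𝔸)‖ ≤ 1) (R a ℓR ℓa : ι → 𝔸) {t : ℝ}
    (ht : ∀ i, ‖((v⁻¹ : 𝔸ˣ) : 𝔸) * (R i * a i) - 1‖ ≤ t) (ht4 : t ≤ 1 / 4) :
    ‖(v : 𝔸) * eml (fun i => ((v⁻¹ : 𝔸ˣ) : 𝔸) * (R i * a i)) - 1 - ((Fintype.card ι : ℂ))⁻¹ • ∑ i, (ℓR i + ℓa i)‖
      ≤ (Fintype.card ι : ℝ)⁻¹ * ∑ i, (‖R i - 1 - ℓR i‖ + ‖a i - 1 - ℓa i‖ + ‖R i - 1‖ * ‖a i - 1‖) + 6 * t ^ 2 := by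
  refine (norm_mul_eml_sub_one_sub_mean_le v hv (fun i => R i * a i) (fun i => ℓR i + ℓa i) ht ht4).trans (add_le_add ?_ le_rfl)
  exact mul_le_mul_of_nonneg_left (Finset.sum_le_sum fun i _ => norm_mul_sub_one_sub_add_le (R i) (a i) (ℓR i) (ℓa i)) (by positivity)

end Abstract

/-! ## §2 The reading on the accumulated frames of the covariant double-bar tower, pointwise -/

section Frames

variable {P : Params} {𝔸 : Type*} [NormedRing 𝔸] [NormedAlgebra ℂ 𝔸] [CompleteSpace 𝔸]

/-- ★★ **THE ONE-STEP ACCUMULATED-FRAME INEQUALITY AT SECOND ORDER, POINTWISE** (twin of ✓`norm_frameAccU_succ_sub_one_le`): `‖v_k(emb y)‖ ≤ 1`, background stairs `ν_i` bi-contractive, every twisted stair transporter within `t ≤ ¼` of `1`, abstract linear parts `ℓ_k` (frames), `ℓR` (stair ratios) ⟹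
`‖v_{k+1}(y) − 1 − |Idx|⁻¹Σ_i (ℓR i + ν_i·ℓ_k(x_i)·ν_i⁻¹)‖ ≤ |Idx|⁻¹Σ_i (‖R_i − 1 − ℓR i‖ + ‖v_k(x_i) − 1 − ℓ_k(x_i)‖ + ‖R_i − 1‖·‖a_i − 1‖) + 6t²`.
[cite: Balaban1985Averaging, (82) p.30, (97) p.32, (26)-(27) p.22] -/
theorem norm_frameAccU_succ_sub_one_sub_lin_le (k : ℕ) (U₀ W : GaugeField P 0 𝔸ˣ) (y : Site P (k + 1)) {t : ℝ}
    (hv : ‖(frameAccU k U₀ W (emb y) : 𝔸)‖ ≤ 1)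
    (hν : ∀ i : Idx P, ‖((holT (emlIterU k U₀) (emb y) (stairWord i.2.1 (off i.1)) : 𝔸ˣ) : 𝔸)‖ ≤ 1 ∧
      ‖(((holT (emlIterU k U₀) (emb y) (stairWord i.2.1 (off i.1)))⁻¹ : 𝔸ˣ) : 𝔸)‖ ≤ 1)
    (ht : ∀ i : Idx P, ‖((tstairU (emlIterU k U₀) (dbarCovIterU k U₀ W) y i : 𝔸ˣ) : 𝔸) - 1‖ ≤ t) (ht4 : t ≤ 1 / 4)
    (ℓk : Site P k → 𝔸) (ℓR : Idx P → 𝔸) :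
    ‖(frameAccU (k + 1) U₀ W y : 𝔸) - 1
        - ((Fintype.card (Idx P) : ℂ))⁻¹ • ∑ i : Idx P,
            (ℓR i + ((holT (emlIterU k U₀) (emb y) (stairWord i.2.1 (off i.1)) : 𝔸ˣ) : 𝔸) * ℓk (transl (emb y) (disp (stairWord i.2.1 (off i.1))))
              * (((holT (emlIterU k U₀) (emb y) (stairWord i.2.1 (off i.1)))⁻¹ : 𝔸ˣ) : 𝔸))‖
      ≤ (Fintype.card (Idx P) : ℝ)⁻¹ * ∑ i : Idx P,
          (‖((holT (emlIterU k W) (emb y) (stairWord i.2.1 (off i.1)) * (holT (emlIterU k U₀) (emb y) (stairWord i.2.1 (off i.1)))⁻¹ : 𝔸ˣ) : 𝔸) - 1 - ℓR i‖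
            + ‖(frameAccU k U₀ W (transl (emb y) (disp (stairWord i.2.1 (off i.1)))) : 𝔸) - 1 - ℓk (transl (emb y) (disp (stairWord i.2.1 (off i.1))))‖
            + ‖((holT (emlIterU k W) (emb y) (stairWord i.2.1 (off i.1)) * (holT (emlIterU k U₀) (emb y) (stairWord i.2.1 (off i.1)))⁻¹ : 𝔸ˣ) : 𝔸) - 1‖
              * ‖((holT (emlIterU k U₀) (emb y) (stairWord i.2.1 (off i.1)) * frameAccU k U₀ W (transl (emb y) (disp (stairWord i.2.1 (off i.1))))
                  * (holT (emlIterU k U₀) (emb y) (stairWord i.2.1 (off i.1)))⁻¹ : 𝔸ˣ) : 𝔸) - 1‖)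
        + 6 * t ^ 2 := by
  rw [frameAccU_succ, Units.val_mul, coe_vframeCovU]
  have e : (fun i : Idx P => ((tstairU (emlIterU k U₀) (dbarCovIterU k U₀ W) y i : 𝔸ˣ) : 𝔸))
      = fun i : Idx P => (((frameAccU k U₀ W (emb y))⁻¹ : 𝔸ˣ) : 𝔸)
        * (((holT (emlIterU k W) (emb y) (stairWord i.2.1 (off i.1)) * (holT (emlIterU k U₀) (emb y) (stairWord i.2.1 (off i.1)))⁻¹ : 𝔸ˣ) : 𝔸)
          * ((holT (emlIterU k U₀) (emb y) (stairWord i.2.1 (off i.1)) * frameAccU k U₀ W (transl (emb y) (disp (stairWord i.2.1 (off i.1))))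
            * (holT (emlIterU k U₀) (emb y) (stairWord i.2.1 (off i.1)))⁻¹ : 𝔸ˣ) : 𝔸)) := by
    funext i
    rw [tstairU_eq_frame_inv_mul, Units.val_mul, Units.val_mul]
  have ht' : ∀ i : Idx P, ‖(((frameAccU k U₀ W (emb y))⁻¹ : 𝔸ˣ) : 𝔸)
        * (((holT (emlIterU k W) (emb y) (stairWord i.2.1 (off i.1)) * (holT (emlIterU k U₀) (emb y) (stairWord i.2.1 (off i.1)))⁻¹ : 𝔸ˣ) : 𝔸)
          * ((holT (emlIterU k U₀) (emb y) (stairWord i.2.1 (off i.1)) * frameAccU k U₀ W (transl (emb y) (disp (stairWord i.2.1 (off i.1))))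
            * (holT (emlIterU k U₀) (emb y) (stairWord i.2.1 (off i.1)))⁻¹ : 𝔸ˣ) : 𝔸)) - 1‖ ≤ t := by
    intro i
    have h := ht i
    rwa [tstairU_eq_frame_inv_mul, Units.val_mul, Units.val_mul] at h
  rw [e]
  refine (norm_mul_eml_sub_one_sub_mean_le_split (frameAccU k U₀ W (emb y)) hv _ _ ℓR
    (fun i : Idx P => ((holT (emlIterU k U₀) (emb y) (stairWord i.2.1 (off i.1)) : 𝔸ˣ) : 𝔸) * ℓk (transl (emb y) (disp (stairWord i.2.1 (off i.1))))
      * (((holT (emlIterU k U₀) (emb y) (stairWord i.2.1 (off i.1)))⁻¹ : 𝔸ˣ) : 𝔸)) ht' ht4).trans (add_le_add ?_ le_rfl)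
  refine mul_le_mul_of_nonneg_left (Finset.sum_le_sum fun i _ => ?_) (by positivity)
  -- the conjugated end frame: `a_i − 1 − ν_iℓ_k(x_i)ν_i⁻¹ = ν_i(v_k(x_i) − 1 − ℓ_k(x_i))ν_i⁻¹`
  have hai : ‖((holT (emlIterU k U₀) (emb y) (stairWord i.2.1 (off i.1)) * frameAccU k U₀ W (transl (emb y) (disp (stairWord i.2.1 (off i.1))))
        * (holT (emlIterU k U₀) (emb y) (stairWord i.2.1 (off i.1)))⁻¹ : 𝔸ˣ) : 𝔸) - 1
        - ((holT (emlIterU k U₀) (emb y) (stairWord i.2.1 (off i.1)) : 𝔸ˣ) : 𝔸) * ℓk (transl (emb y) (disp (stairWord i.2.1 (off i.1))))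
          * (((holT (emlIterU k U₀) (emb y) (stairWord i.2.1 (off i.1)))⁻¹ : 𝔸ˣ) : 𝔸)‖
      ≤ ‖(frameAccU k U₀ W (transl (emb y) (disp (stairWord i.2.1 (off i.1)))) : 𝔸) - 1 - ℓk (transl (emb y) (disp (stairWord i.2.1 (off i.1))))‖ := by
    rw [Units.val_mul, Units.val_mul]
    exact norm_conj_sub_one_sub_le _ _ _ (hν i).1 (hν i).2
  linarith [hai]

end Frames

/-! ## §3 ★★★ The `ℓ¹` step over the coarse sites -/

section Step

variable {P : Params} {𝔸 : Type*} [NormedRing 𝔸] [NormedAlgebra ℂ 𝔸] [CompleteSpace 𝔸] {k : ℕ}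

/-- the index mean of a function of the stair ends, summed over the coarse sites, is `(Lᵈ)⁻¹·Σ_x` (✓`idxMean_eq_blockMean` + the block tiling). [cite: Balaban1987RG1, (0.3)-(0.4) pp.252-253] -/
theorem sum_idxMean_eq (hk : k + 1 ≤ P.m + P.K) (f : Site P k → ℝ) :
    ∑ y : Site P (k + 1), (Fintype.card (Idx P) : ℝ)⁻¹ * ∑ i : Idx P, f (transl (emb y) (disp (stairWord i.2.1 (off i.1))))
      = ((P.L : ℝ) ^ P.d)⁻¹ * ∑ x : Site P k, f x := by
  simp only [idxMean_eq_blockMean]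
  rw [← Finset.mul_sum]
  refine congrArg (fun t : ℝ => ((P.L : ℝ) ^ P.d)⁻¹ * t) ?_
  calc ∑ y : Site P (k + 1), ∑ r : Fin P.d → Fin P.L, f (Site.blockSite y r)
      = ∑ y : Site P (k + 1), ∑ x ∈ block y, f x := Finset.sum_congr rfl fun y _ => sum_blockSite_eq hk y f
    _ = ∑ x : Site P k, f x := sum_sum_block_eq _

set_option maxHeartbeats 400000 in
/-- ★★★ **THE ONE-STEP ACCUMULATED-FRAME INEQUALITY AT SECOND ORDER, IN `ℓ¹`** (see the module docstring): under ✓`frameMass_step_le`'s displayed U1∕sup∕stair rows and window `t* := ρ + 3δ₂ ≤ ¼`,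
with abstract linear parts `ℓ_k`, `ℓR` and their displayed remainder majorants `E`, `SR`:
`Σ_y ‖v_{k+1}(y) − 1 − ℓ_{k+1}(y)‖ ≤ (Lᵈ)⁻¹·Σ_x E x + Σ_y |Idx|⁻¹Σ_i SR y i + 19·C_R²·Σ_y B y + 91·Σ_x ‖v_k(x) − 1‖²`.
[cite: Balaban1985Averaging, (82) p.30, (97) p.32, Prop. 3 (122)-(126) p.36; Balaban1987RG1, (0.3)-(0.4) pp.252-253] -/
theorem frameRem2_step_le (hk : k + 1 ≤ P.m + P.K) (U₀ W : GaugeField P 0 𝔸ˣ) {δ₂ ρ CR : ℝ} (B : Site P (k + 1) → ℝ)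
    (hCR : 0 ≤ CR) (hB0 : ∀ y, 0 ≤ B y) (hδ₂ : 0 ≤ δ₂) (hρ : 0 ≤ ρ)
    (hv1 : ∀ x : Site P k, ‖(frameAccU k U₀ W x : 𝔸)‖ ≤ 1)
    (hv1' : ∀ x : Site P k, ‖(((frameAccU k U₀ W x)⁻¹ : 𝔸ˣ) : 𝔸)‖ ≤ 1)
    (hν : ∀ (y : Site P (k + 1)) (i : Idx P), ‖((holT (emlIterU k U₀) (emb y) (stairWord i.2.1 (off i.1)) : 𝔸ˣ) : 𝔸)‖ ≤ 1 ∧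
      ‖(((holT (emlIterU k U₀) (emb y) (stairWord i.2.1 (off i.1)))⁻¹ : 𝔸ˣ) : 𝔸)‖ ≤ 1)
    (hv2 : ∀ x : Site P k, ‖(frameAccU k U₀ W x : 𝔸) - 1‖ ≤ δ₂)
    (hR : ∀ (y : Site P (k + 1)) (i : Idx P),
      ‖((holT (emlIterU k W) (emb y) (stairWord i.2.1 (off i.1)) * (holT (emlIterU k U₀) (emb y) (stairWord i.2.1 (off i.1)))⁻¹ : 𝔸ˣ) : 𝔸) - 1‖ ≤ CR * Real.sqrt (B y))
    (hρB : ∀ y, CR * Real.sqrt (B y) ≤ ρ) (ht : ρ + 3 * δ₂ ≤ 1 / 4)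
    (ℓk : Site P k → 𝔸) (E : Site P k → ℝ) (hE : ∀ x, ‖(frameAccU k U₀ W x : 𝔸) - 1 - ℓk x‖ ≤ E x)
    (ℓR : Site P (k + 1) → Idx P → 𝔸) (SR : Site P (k + 1) → Idx P → ℝ)
    (hSR : ∀ (y : Site P (k + 1)) (i : Idx P),
      ‖((holT (emlIterU k W) (emb y) (stairWord i.2.1 (off i.1)) * (holT (emlIterU k U₀) (emb y) (stairWord i.2.1 (off i.1)))⁻¹ : 𝔸ˣ) : 𝔸) - 1 - ℓR y i‖ ≤ SR y i) :
    ∑ y : Site P (k + 1), ‖(frameAccU (k + 1) U₀ W y : 𝔸) - 1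
        - ((Fintype.card (Idx P) : ℂ))⁻¹ • ∑ i : Idx P,
            (ℓR y i + ((holT (emlIterU k U₀) (emb y) (stairWord i.2.1 (off i.1)) : 𝔸ˣ) : 𝔸) * ℓk (transl (emb y) (disp (stairWord i.2.1 (off i.1))))
              * (((holT (emlIterU k U₀) (emb y) (stairWord i.2.1 (off i.1)))⁻¹ : 𝔸ˣ) : 𝔸))‖
      ≤ ((P.L : ℝ) ^ P.d)⁻¹ * ∑ x : Site P k, E x
        + ∑ y : Site P (k + 1), (Fintype.card (Idx P) : ℝ)⁻¹ * ∑ i : Idx P, SR y i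
        + 19 * CR ^ 2 * ∑ y : Site P (k + 1), B y
        + 91 * ∑ x : Site P k, ‖(frameAccU k U₀ W x : 𝔸) - 1‖ ^ 2 := by
  have ht0 : 0 ≤ ρ + 3 * δ₂ := by positivity
  -- the pointwise bound at every coarse site
  have hpt : ∀ y : Site P (k + 1), ‖(frameAccU (k + 1) U₀ W y : 𝔸) - 1
        - ((Fintype.card (Idx P) : ℂ))⁻¹ • ∑ i : Idx P,
            (ℓR y i + ((holT (emlIterU k U₀) (emb y) (stairWord i.2.1 (off i.1)) : 𝔸ˣ) : 𝔸) * ℓk (transl (emb y) (disp (stairWord i.2.1 (off i.1))))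
              * (((holT (emlIterU k U₀) (emb y) (stairWord i.2.1 (off i.1)))⁻¹ : 𝔸ˣ) : 𝔸))‖
      ≤ (Fintype.card (Idx P) : ℝ)⁻¹ * ∑ i : Idx P, SR y i
        + (Fintype.card (Idx P) : ℝ)⁻¹ * ∑ i : Idx P, E (transl (emb y) (disp (stairWord i.2.1 (off i.1))))
        + (1 / 2 * (CR ^ 2 * B y) + 1 / 2 * ((Fintype.card (Idx P) : ℝ)⁻¹ * ∑ i : Idx P, ‖(frameAccU k U₀ W (transl (emb y) (disp (stairWord i.2.1 (off i.1)))) : 𝔸) - 1‖ ^ 2))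
        + 18 * (CR ^ 2 * B y + ∑ r : Fin P.d → Fin P.L, ‖(frameAccU k U₀ W (Site.blockSite y r) : 𝔸) - 1‖ ^ 2 + 4 * ‖(frameAccU k U₀ W (emb y) : 𝔸) - 1‖ ^ 2) := by
    intro y
    have hcard : (0 : ℝ) < Fintype.card (Idx P) := Nat.cast_pos.2 Fintype.card_pos
    -- letters at `y` (as in ✓`frameMass_step_le`)
    have hVi : ∀ i : Idx P, ‖(frameAccU k U₀ W (transl (emb y) (disp (stairWord i.2.1 (off i.1)))) : 𝔸) - 1‖
        ≤ Real.sqrt (∑ r : Fin P.d → Fin P.L, ‖(frameAccU k U₀ W (Site.blockSite y r) : 𝔸) - 1‖ ^ 2) := by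
      intro i
      rw [transl_emb_disp_stairWord_eq_blockSite, ← Real.sqrt_sq (norm_nonneg _)]
      exact Real.sqrt_le_sqrt (Finset.single_le_sum (f := fun r => ‖(frameAccU k U₀ W (Site.blockSite y r) : 𝔸) - 1‖ ^ 2)
        (fun r _ => sq_nonneg _) (Finset.mem_univ i.1))
    have ha1 : ∀ i : Idx P, ‖((holT (emlIterU k U₀) (emb y) (stairWord i.2.1 (off i.1)) * frameAccU k U₀ W (transl (emb y) (disp (stairWord i.2.1 (off i.1))))
            * (holT (emlIterU k U₀) (emb y) (stairWord i.2.1 (off i.1)))⁻¹ : 𝔸ˣ) : 𝔸) - 1‖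
        ≤ ‖(frameAccU k U₀ W (transl (emb y) (disp (stairWord i.2.1 (off i.1)))) : 𝔸) - 1‖ :=
      fun i => norm_conj_sub_one_le _ _ (hν y i).1 (hν y i).2
    have ha : ∀ i : Idx P, ‖((holT (emlIterU k U₀) (emb y) (stairWord i.2.1 (off i.1)) * frameAccU k U₀ W (transl (emb y) (disp (stairWord i.2.1 (off i.1))))
            * (holT (emlIterU k U₀) (emb y) (stairWord i.2.1 (off i.1)))⁻¹ : 𝔸ˣ) : 𝔸)‖ ≤ 1 :=
      fun i => norm_conj_le_one _ _ (hν y i).1 (hν y i).2 (hv1 _)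
    -- the local sup `t_y ≤ min (t*) (T_y)`
    set Ty : ℝ := CR * Real.sqrt (B y) + Real.sqrt (∑ r : Fin P.d → Fin P.L, ‖(frameAccU k U₀ W (Site.blockSite y r) : 𝔸) - 1‖ ^ 2)
        + 2 * ‖(frameAccU k U₀ W (emb y) : 𝔸) - 1‖ with hTy
    have hTy0 : 0 ≤ Ty := by rw [hTy]; positivity
    have htst : ∀ i : Idx P, ‖((tstairU (emlIterU k U₀) (dbarCovIterU k U₀ W) y i : 𝔸ˣ) : 𝔸) - 1‖ ≤ min (ρ + 3 * δ₂) Ty := by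
      intro i
      rw [tstairU_eq_frame_inv_mul, Units.val_mul]
      refine (norm_inv_mul_sub_one_le _ (hv1' _) _).trans ?_
      rw [Units.val_mul]
      have hvc2 : ‖(((frameAccU k U₀ W (emb y))⁻¹ : 𝔸ˣ) : 𝔸) - 1‖ ≤ 2 * ‖(frameAccU k U₀ W (emb y) : 𝔸) - 1‖ :=
        B7Prop6Flat.norm_units_inv_sub_one_le _ ((hv2 _).trans (by linarith))
      have h3 : ‖((holT (emlIterU k W) (emb y) (stairWord i.2.1 (off i.1)) * (holT (emlIterU k U₀) (emb y) (stairWord i.2.1 (off i.1)))⁻¹ : 𝔸ˣ) : 𝔸)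
          * ((holT (emlIterU k U₀) (emb y) (stairWord i.2.1 (off i.1)) * frameAccU k U₀ W (transl (emb y) (disp (stairWord i.2.1 (off i.1))))
            * (holT (emlIterU k U₀) (emb y) (stairWord i.2.1 (off i.1)))⁻¹ : 𝔸ˣ) : 𝔸) - 1‖
          ≤ CR * Real.sqrt (B y) + ‖(frameAccU k U₀ W (transl (emb y) (disp (stairWord i.2.1 (off i.1)))) : 𝔸) - 1‖ := by
        have e : ∀ R' a' : 𝔸, R' * a' - 1 = (R' - 1) * a' + (a' - 1) := fun R' a' => by noncomm_ring
        rw [e]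
        refine (norm_add_le _ _).trans (add_le_add ?_ (ha1 i))
        exact (norm_mul_le _ _).trans ((mul_le_mul (hR y i) (ha i) (norm_nonneg _) (by positivity)).trans (le_of_eq (mul_one _)))
      refine le_min ?_ ?_
      · have := hVi i
        linarith [hv2 (transl (emb y) (disp (stairWord i.2.1 (off i.1)))), hv2 (emb y), hρB y]
      · rw [hTy]; linarith [hVi i]
    have hmin4 : min (ρ + 3 * δ₂) Ty ≤ 1 / 4 := (min_le_left _ _).trans ht
    have hB1 := norm_frameAccU_succ_sub_one_sub_lin_le k U₀ W y (hv1 _) (hν y) htst hmin4 ℓk (ℓR y)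
    -- `6·min² ≤ 6·T_y² ≤ 18(CR²B + V + 4‖v_k(c) − 1‖²)`
    have hmin2 : 6 * (min (ρ + 3 * δ₂) Ty) ^ 2
        ≤ 18 * (CR ^ 2 * B y + ∑ r : Fin P.d → Fin P.L, ‖(frameAccU k U₀ W (Site.blockSite y r) : 𝔸) - 1‖ ^ 2 + 4 * ‖(frameAccU k U₀ W (emb y) : 𝔸) - 1‖ ^ 2) := by
      have hm0 : 0 ≤ min (ρ + 3 * δ₂) Ty := le_min ht0 hTy0
      have hmT : min (ρ + 3 * δ₂) Ty ≤ Ty := min_le_right _ _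
      have hsq : (min (ρ + 3 * δ₂) Ty) ^ 2 ≤ Ty ^ 2 := pow_le_pow_left₀ hm0 hmT 2
      have h3sq : ∀ a b c : ℝ, (a + b + c) ^ 2 ≤ 3 * (a ^ 2 + b ^ 2 + c ^ 2) := fun a b c => by
        nlinarith [sq_nonneg (a - b), sq_nonneg (a - c), sq_nonneg (b - c)]
      have hT2 := h3sq (CR * Real.sqrt (B y)) (Real.sqrt (∑ r : Fin P.d → Fin P.L, ‖(frameAccU k U₀ W (Site.blockSite y r) : 𝔸) - 1‖ ^ 2))
        (2 * ‖(frameAccU k U₀ W (emb y) : 𝔸) - 1‖)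
      have e1 : (CR * Real.sqrt (B y)) ^ 2 = CR ^ 2 * B y := by rw [mul_pow, Real.sq_sqrt (hB0 y)]
      have e2 : (Real.sqrt (∑ r : Fin P.d → Fin P.L, ‖(frameAccU k U₀ W (Site.blockSite y r) : 𝔸) - 1‖ ^ 2)) ^ 2
          = ∑ r : Fin P.d → Fin P.L, ‖(frameAccU k U₀ W (Site.blockSite y r) : 𝔸) - 1‖ ^ 2 := Real.sq_sqrt (Finset.sum_nonneg fun r _ => sq_nonneg _)
      have e3 : (2 * ‖(frameAccU k U₀ W (emb y) : 𝔸) - 1‖) ^ 2 = 4 * ‖(frameAccU k U₀ W (emb y) : 𝔸) - 1‖ ^ 2 := by ring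
      rw [← hTy, e1, e2, e3] at hT2
      nlinarith [hsq, hT2]
    -- the mean of the three pointwise terms
    have hmean : (Fintype.card (Idx P) : ℝ)⁻¹ * ∑ i : Idx P,
          (‖((holT (emlIterU k W) (emb y) (stairWord i.2.1 (off i.1)) * (holT (emlIterU k U₀) (emb y) (stairWord i.2.1 (off i.1)))⁻¹ : 𝔸ˣ) : 𝔸) - 1 - ℓR y i‖
            + ‖(frameAccU k U₀ W (transl (emb y) (disp (stairWord i.2.1 (off i.1)))) : 𝔸) - 1 - ℓk (transl (emb y) (disp (stairWord i.2.1 (off i.1))))‖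
            + ‖((holT (emlIterU k W) (emb y) (stairWord i.2.1 (off i.1)) * (holT (emlIterU k U₀) (emb y) (stairWord i.2.1 (off i.1)))⁻¹ : 𝔸ˣ) : 𝔸) - 1‖
              * ‖((holT (emlIterU k U₀) (emb y) (stairWord i.2.1 (off i.1)) * frameAccU k U₀ W (transl (emb y) (disp (stairWord i.2.1 (off i.1))))
                  * (holT (emlIterU k U₀) (emb y) (stairWord i.2.1 (off i.1)))⁻¹ : 𝔸ˣ) : 𝔸) - 1‖)
        ≤ (Fintype.card (Idx P) : ℝ)⁻¹ * ∑ i : Idx P, SR y i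
          + (Fintype.card (Idx P) : ℝ)⁻¹ * ∑ i : Idx P, E (transl (emb y) (disp (stairWord i.2.1 (off i.1))))
          + (1 / 2 * (CR ^ 2 * B y) + 1 / 2 * ((Fintype.card (Idx P) : ℝ)⁻¹ * ∑ i : Idx P, ‖(frameAccU k U₀ W (transl (emb y) (disp (stairWord i.2.1 (off i.1)))) : 𝔸) - 1‖ ^ 2)) := by
      rw [Finset.sum_add_distrib, Finset.sum_add_distrib, mul_add, mul_add]
      refine add_le_add (add_le_add ?_ ?_) ?_
      · exact mul_le_mul_of_nonneg_left (Finset.sum_le_sum fun i _ => hSR y i) (by positivity)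
      · exact mul_le_mul_of_nonneg_left (Finset.sum_le_sum fun i _ => hE _) (by positivity)
      · -- AM–GM on the cross term: `‖R−1‖‖a−1‖ ≤ ½(CR√B)² + ½‖v_k(x_i) − 1‖²`
        have hx : ∀ i : Idx P,
            ‖((holT (emlIterU k W) (emb y) (stairWord i.2.1 (off i.1)) * (holT (emlIterU k U₀) (emb y) (stairWord i.2.1 (off i.1)))⁻¹ : 𝔸ˣ) : 𝔸) - 1‖
              * ‖((holT (emlIterU k U₀) (emb y) (stairWord i.2.1 (off i.1)) * frameAccU k U₀ W (transl (emb y) (disp (stairWord i.2.1 (off i.1))))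
                  * (holT (emlIterU k U₀) (emb y) (stairWord i.2.1 (off i.1)))⁻¹ : 𝔸ˣ) : 𝔸) - 1‖
            ≤ 1 / 2 * (CR ^ 2 * B y) + 1 / 2 * ‖(frameAccU k U₀ W (transl (emb y) (disp (stairWord i.2.1 (off i.1)))) : 𝔸) - 1‖ ^ 2 := by
          intro i
          have h1 := hR y i
          have h2 := ha1 i
          have hsq : (CR * Real.sqrt (B y)) ^ 2 = CR ^ 2 * B y := by rw [mul_pow, Real.sq_sqrt (hB0 y)]
          have h0a : 0 ≤ ‖((holT (emlIterU k W) (emb y) (stairWord i.2.1 (off i.1)) * (holT (emlIterU k U₀) (emb y) (stairWord i.2.1 (off i.1)))⁻¹ : 𝔸ˣ) : 𝔸) - 1‖ :=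
            norm_nonneg _
          have h0b : 0 ≤ ‖((holT (emlIterU k U₀) (emb y) (stairWord i.2.1 (off i.1)) * frameAccU k U₀ W (transl (emb y) (disp (stairWord i.2.1 (off i.1))))
                  * (holT (emlIterU k U₀) (emb y) (stairWord i.2.1 (off i.1)))⁻¹ : 𝔸ˣ) : 𝔸) - 1‖ := norm_nonneg _
          nlinarith [mul_le_mul h1 h2 h0b ((norm_nonneg _).trans h1), hsq,
            sq_nonneg (CR * Real.sqrt (B y) - ‖(frameAccU k U₀ W (transl (emb y) (disp (stairWord i.2.1 (off i.1)))) : 𝔸) - 1‖)]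
        calc (Fintype.card (Idx P) : ℝ)⁻¹ * ∑ i : Idx P,
              ‖((holT (emlIterU k W) (emb y) (stairWord i.2.1 (off i.1)) * (holT (emlIterU k U₀) (emb y) (stairWord i.2.1 (off i.1)))⁻¹ : 𝔸ˣ) : 𝔸) - 1‖
                * ‖((holT (emlIterU k U₀) (emb y) (stairWord i.2.1 (off i.1)) * frameAccU k U₀ W (transl (emb y) (disp (stairWord i.2.1 (off i.1))))
                    * (holT (emlIterU k U₀) (emb y) (stairWord i.2.1 (off i.1)))⁻¹ : 𝔸ˣ) : 𝔸) - 1‖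
            ≤ (Fintype.card (Idx P) : ℝ)⁻¹ * ∑ i : Idx P, (1 / 2 * (CR ^ 2 * B y) + 1 / 2 * ‖(frameAccU k U₀ W (transl (emb y) (disp (stairWord i.2.1 (off i.1)))) : 𝔸) - 1‖ ^ 2) :=
              mul_le_mul_of_nonneg_left (Finset.sum_le_sum fun i _ => hx i) (by positivity)
          _ = 1 / 2 * (CR ^ 2 * B y) + 1 / 2 * ((Fintype.card (Idx P) : ℝ)⁻¹ * ∑ i : Idx P, ‖(frameAccU k U₀ W (transl (emb y) (disp (stairWord i.2.1 (off i.1)))) : 𝔸) - 1‖ ^ 2) := by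
              rw [Finset.sum_add_distrib, Finset.sum_const, Finset.card_univ, nsmul_eq_mul, mul_add, ← Finset.mul_sum]
              have hc : (Fintype.card (Idx P) : ℝ)⁻¹ * ((Fintype.card (Idx P) : ℝ) * (1 / 2 * (CR ^ 2 * B y))) = 1 / 2 * (CR ^ 2 * B y) := by
                rw [← mul_assoc, inv_mul_cancel₀ hcard.ne', one_mul]
              rw [hc]
              ring
    linarith [hB1, hmean, hmin2]
  refine (Finset.sum_le_sum fun y _ => hpt y).trans ?_
  simp only [Finset.sum_add_distrib]
  -- the four `ℓ¹` letters
  have hE1 := sum_idxMean_eq hk E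
  have hF1 := sum_idxMean_eq hk (fun x => ‖(frameAccU k U₀ W x : 𝔸) - 1‖ ^ 2)
  have h3 : ∑ y : Site P (k + 1), ∑ r : Fin P.d → Fin P.L, ‖(frameAccU k U₀ W (Site.blockSite y r) : 𝔸) - 1‖ ^ 2 = ∑ x : Site P k, ‖(frameAccU k U₀ W x : 𝔸) - 1‖ ^ 2 := by
    calc ∑ y : Site P (k + 1), ∑ r : Fin P.d → Fin P.L, ‖(frameAccU k U₀ W (Site.blockSite y r) : 𝔸) - 1‖ ^ 2
        = ∑ y : Site P (k + 1), ∑ x ∈ block y, ‖(frameAccU k U₀ W x : 𝔸) - 1‖ ^ 2 :=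
          Finset.sum_congr rfl fun y _ => sum_blockSite_eq hk y (fun x => ‖(frameAccU k U₀ W x : 𝔸) - 1‖ ^ 2)
      _ = ∑ x : Site P k, ‖(frameAccU k U₀ W x : 𝔸) - 1‖ ^ 2 := sum_sum_block_eq _
  have h4 := sum_emb_le hk (fun x => ‖(frameAccU k U₀ W x : 𝔸) - 1‖ ^ 2) fun x => sq_nonneg _
  have hΦ0 : 0 ≤ ∑ x : Site P k, ‖(frameAccU k U₀ W x : 𝔸) - 1‖ ^ 2 := Finset.sum_nonneg fun x _ => sq_nonneg _
  have hLd : ((P.L : ℝ) ^ P.d)⁻¹ ≤ 1 := by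
    have h1 : (1 : ℝ) ≤ (P.L : ℝ) ^ P.d := one_le_pow₀ (by exact_mod_cast P.L_pos)
    exact inv_le_one_of_one_le₀ h1
  -- assemble
  have s1a : ∑ y : Site P (k + 1), 1 / 2 * (CR ^ 2 * B y) = 1 / 2 * (CR ^ 2 * ∑ y : Site P (k + 1), B y) := by
    rw [← Finset.mul_sum, ← Finset.mul_sum]
  have s1b : ∑ y : Site P (k + 1), 1 / 2 * ((Fintype.card (Idx P) : ℝ)⁻¹ * ∑ i : Idx P,
        ‖(frameAccU k U₀ W (transl (emb y) (disp (stairWord i.2.1 (off i.1)))) : 𝔸) - 1‖ ^ 2)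
      = 1 / 2 * (((P.L : ℝ) ^ P.d)⁻¹ * ∑ x : Site P k, ‖(frameAccU k U₀ W x : 𝔸) - 1‖ ^ 2) := by
    rw [← Finset.mul_sum, hF1]
  have s2 : ∑ y : Site P (k + 1), 18 * (CR ^ 2 * B y + ∑ r : Fin P.d → Fin P.L, ‖(frameAccU k U₀ W (Site.blockSite y r) : 𝔸) - 1‖ ^ 2
        + 4 * ‖(frameAccU k U₀ W (emb y) : 𝔸) - 1‖ ^ 2)
      = 18 * (CR ^ 2 * ∑ y : Site P (k + 1), B y + ∑ x : Site P k, ‖(frameAccU k U₀ W x : 𝔸) - 1‖ ^ 2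
        + 4 * ∑ y : Site P (k + 1), ‖(frameAccU k U₀ W (emb y) : 𝔸) - 1‖ ^ 2) := by
    rw [← Finset.mul_sum, Finset.sum_add_distrib, Finset.sum_add_distrib, ← Finset.mul_sum, ← Finset.mul_sum, h3]
  have hLdΦ : ((P.L : ℝ) ^ P.d)⁻¹ * ∑ x : Site P k, ‖(frameAccU k U₀ W x : 𝔸) - 1‖ ^ 2 ≤ ∑ x : Site P k, ‖(frameAccU k U₀ W x : 𝔸) - 1‖ ^ 2 := by
    have := mul_le_mul_of_nonneg_right hLd hΦ0
    rwa [one_mul] at this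
  have hB : 0 ≤ CR ^ 2 * ∑ y : Site P (k + 1), B y := mul_nonneg (sq_nonneg _) (Finset.sum_nonneg fun y _ => hB0 y)
  linarith [hE1, s1a, s1b, s2, h4, hLdΦ, hB, hΦ0]

end Step

end Summit.QuantumFields.YangMills.Theorems.Prop7FrameRem2Step

end
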